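import Summits.CriticalPhenomena.PercolationContinuityZ3.Theorems.PercNearOneGluingNoHeavyLowerTailSahiE3PrincipalMeetFKGLoad
import Literature.Probability.LatticeModels.StrassenHolleyCoupling
import Mathlib.Tactic.Linarith
import Mathlib.Tactic.Ring
import HarnessLib
import HarnessLib.Audit

/-!
# `NoHeavyLowerTail` (crux stmt-CriticalPhenomena-4575), Sahi programme P4 (Holley / monotone coupling):
# locality of Sahi's `C₃` in the intersection for FKG weights — the fibres of `x ↦ x ⊓ w` (lemmas, steps 1–3)

Support file (cell `prim-l12`, seat P4; `--supports stmt-CriticalPhenomena-4575`): the lemma half of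
`…SahiE3DeterminedMeetFKG.latticeE3_nonneg_of_inter_determined` (Sahi's `C₃` under EVERY nonnegative log-supermodular weight on a
finite distributive lattice for up-set triples `(U, A, B)` whose intersection `A ∩ B` is `w`-determined, GIVEN `C₃` for the
`w`-cylinder triple `(V, A*, B*)`; statement, context and proof sketch in that file's docstring).  No named facts, no sorries; the
`def`s are proof devices.

Contents (`Z = m(univ)`, `a = m(A)`, `b = m(B)`, `A* = starUp A w`, `B* = starUp B w`):
* `sum_mul_nonneg_of_ratioMonotone` — a RATIO-MONOTONE LAYER CAKE on a finite preorder: if `0 ≤ m ≤`-a.c. `ν`, the ratio `m/ν` is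
  monotone in the division-free sense `m z · ν z' ≤ ν z · m z'` (`z ≤ z'`), and `φ` has nonnegative `ν`-sums on up-sets, then
  `Σ φ·m ≥ 0` (the tree's `Literature.Probability.LatticeModels.sum_mul_nonneg_of_upperSets` applied to the monotone envelope
  `max_{z' ≤ z, ν z' > 0} m z'/ν z'`);
* objects `infFibre S w z = {x ∈ S | x ⊓ w = z}`, `cylInf S w = {x | x ⊓ w ∈ S}`, and the dominated first-slot density
  `densStar = 2Z²·1_{A∩B} + ab − Z·m(A∩B) − Za·1_{B*} − Zb·1_{A*}`; `starUp_inter_starUp_of_determined`: `A* ∩ B* = A ∩ B`;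
* STEP 1 `sum_densStar_le_latticeE3`: `Σ_{x∈U} μ x · densStar x ≤ latticeE3 μ U A B` (`A ⊆ A*`, `B ⊆ B*`);
* STEP 2 `latticeE3_star_le_sum_densStar`: `latticeE3 μ V A* B* ≤ Σ_{x∈V} μ x · densStar x` for every up-set `V` (FKG for
  `(V, A*)`, `(V, B*)`: the "tangent corner" `(â − a)(b̂ − b) ≥ 0` of the seat's gen-3 `…SahiE3JuntaMeetBlock`);
* STEP 3 `sum_densStar_eq_sum_fibre` (grouping `Σ_{x∈U} μ x · densStar x = Σ_z densStar z · m(U ∩ {x ⊓ w = z})`) and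
  `mass_infFibre_ratio_mono` — Ahlswede–Daykin: `m(U ∩ F_z)·m(F_{z'}) ≤ m(F_z)·m(U ∩ F_{z'})` for `z ≤ z'`, `F_z = {x | x ⊓ w = z}`
  (Holley: `μ(U | x ⊓ w = z)` increases with `z`).
-/

namespace Summit.CriticalPhenomena.PercolationContinuityZ3.Theorems.SahiE3DeterminedMeetFKG

open Finset Literature.Probability.LatticeModels
open Summit.CriticalPhenomena.PercolationContinuityZ3.Theorems.C3Transport (density latticeE3_eq_sum_density)
open Summit.CriticalPhenomena.PercolationContinuityZ3.Theorems.SahiE3PrincipalMeetFKG (starUp mem_starUp subset_starUp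
  isUpperSet_starUp inf_mem_starUp)

/-! ### A ratio-monotone layer cake (generic) -/

section LayerCake

variable {β : Type*} [Fintype β] [Preorder β]

/-- **Ratio-monotone layer cake.**  On a finite preorder let `ν ≥ 0`, `0 ≤ m` with `m = 0` where `ν = 0`, and suppose the ratio
`m/ν` is monotone in the division-free sense `m z · ν z' ≤ ν z · m z'` for `z ≤ z'`.  If `φ` has nonnegative `ν`-sums over all up-sets,
then `Σ_z φ z · m z ≥ 0`.  (Apply the layer cake `sum_mul_nonneg_of_upperSets` to the monotone envelope
`h z = max {m z'/ν z' | z' ≤ z, ν z' > 0}`, which equals `m z/ν z` wherever `ν z > 0`.) [this work] -/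
theorem sum_mul_nonneg_of_ratioMonotone (φ ν m : β → ℝ) (hν : ∀ z, 0 ≤ ν z) (hm : ∀ z, 0 ≤ m z)
    (hmν : ∀ z, ν z = 0 → m z = 0) (hratio : ∀ z z', z ≤ z' → m z * ν z' ≤ ν z * m z')
    (hφ : ∀ U : Finset β, IsUpperSet (U : Set β) → 0 ≤ ∑ z ∈ U, φ z * ν z) :
    0 ≤ ∑ z, φ z * m z := by
  classical
  -- the monotone envelope of the ratio
  let T : β → Finset β := fun z => univ.filter fun z' => z' ≤ z ∧ 0 < ν z'
  let h : β → ℝ := fun z => if hT : (T z).Nonempty then (T z).sup' hT (fun z' => m z' / ν z') else 0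
  have hTmono : ∀ {z₁ z₂}, z₁ ≤ z₂ → T z₁ ⊆ T z₂ := by
    intro z₁ z₂ h12 z' hz'
    simp only [T, mem_filter, mem_univ, true_and] at hz' ⊢
    exact ⟨le_trans hz'.1 h12, hz'.2⟩
  have hrat_nonneg : ∀ z', 0 ≤ m z' / ν z' := fun z' => div_nonneg (hm z') (hν z')
  have h0 : ∀ z, 0 ≤ h z := by
    intro z
    simp only [h]
    split_ifs with hT
    · obtain ⟨z₀, hz₀⟩ := hT
      exact le_trans (hrat_nonneg z₀) (Finset.le_sup' (fun z' => m z' / ν z') hz₀)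
    · exact le_rfl
  have hmono : Monotone h := by
    intro z₁ z₂ h12
    simp only [h]
    by_cases hT₁ : (T z₁).Nonempty
    · have hT₂ : (T z₂).Nonempty := hT₁.mono (hTmono h12)
      rw [dif_pos hT₁, dif_pos hT₂]
      exact Finset.sup'_le hT₁ _ fun z' hz' => Finset.le_sup' (fun z' => m z' / ν z') (hTmono h12 hz')
    · rw [dif_neg hT₁]
      split_ifs with hT₂
      · obtain ⟨z₀, hz₀⟩ := hT₂
        exact le_trans (hrat_nonneg z₀) (Finset.le_sup' (fun z' => m z' / ν z') hz₀)
      · exact le_rfl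
  -- on the support the envelope is the ratio itself
  have hkey : ∀ z, ν z * h z = m z := by
    intro z
    rcases (hν z).eq_or_lt with hz | hz
    · rw [← hz, zero_mul, hmν z hz.symm]
    · have hzT : z ∈ T z := by simp [T, hz]
      have hT : (T z).Nonempty := ⟨z, hzT⟩
      have hval : h z = m z / ν z := by
        simp only [h, dif_pos hT]
        refine le_antisymm (Finset.sup'_le hT _ fun z' hz' => ?_) (Finset.le_sup' (fun z' => m z' / ν z') hzT)
        simp only [T, mem_filter, mem_univ, true_and] at hz'
        rw [div_le_div_iff₀ hz'.2 hz, mul_comm (m z) (ν z')]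
        exact hratio z' z hz'.1
      rw [hval, mul_div_cancel₀ _ (ne_of_gt hz)]
  have hsum : ∑ z, φ z * m z = ∑ z, (φ z * ν z) * h z := by
    refine Finset.sum_congr rfl fun z _ => ?_
    rw [mul_assoc, hkey z]
  rw [hsum]
  exact sum_mul_nonneg_of_upperSets (fun z => φ z * ν z) h hφ h0 hmono

end LayerCake

variable {α : Type*} [DistribLattice α] [Fintype α] [DecidableEq α] [DecidableLE α]

/-! ### The objects -/

/-- The fibre of `x ↦ x ⊓ w` over `z` inside `S`: `{x ∈ S | x ⊓ w = z}`. [this work] -/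
def infFibre (S : Finset α) (w z : α) : Finset α := S.filter fun x => x ⊓ w = z

/-- The `w`-cylinder `{x | x ⊓ w ∈ S}` over `S`. [this work] -/
def cylInf (S : Finset α) (w : α) : Finset α := univ.filter fun x => x ⊓ w ∈ S

/-- The dominated first-slot density `densStar = 2Z²·1_{A∩B} + m(A)m(B) − Z·m(A∩B) − Z·m(A)·1_{B*} − Z·m(B)·1_{A*}` (the density of
`C3Transport` with the top sections `A* = starUp A w`, `B* = starUp B w` in the indicator slots). [this work] -/
def densStar (μ : α → ℝ) (A B : Finset α) (w x : α) : ℝ :=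
  2 * mass μ univ ^ 2 * (if x ∈ A ∩ B then 1 else 0) + mass μ A * mass μ B - mass μ univ * mass μ (A ∩ B)
    - mass μ univ * mass μ A * (if x ∈ starUp B w then 1 else 0)
    - mass μ univ * mass μ B * (if x ∈ starUp A w then 1 else 0)

omit [Fintype α] [DecidableLE α] in
/-- Membership in a fibre. [this work] -/
theorem mem_infFibre {S : Finset α} {w z x : α} : x ∈ infFibre S w z ↔ x ∈ S ∧ x ⊓ w = z := by
  simp [infFibre]

omit [DecidableLE α] in
/-- Membership in a cylinder. [this work] -/
theorem mem_cylInf {S : Finset α} {w x : α} : x ∈ cylInf S w ↔ x ⊓ w ∈ S := by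
  simp [cylInf]

omit [DecidableLE α] in
/-- The cylinder over an up-set is an up-set. [this work] -/
theorem isUpperSet_cylInf {S : Finset α} (hS : IsUpperSet (S : Set α)) (w : α) :
    IsUpperSet ((cylInf S w : Finset α) : Set α) := by
  intro x y hxy hx
  rw [Finset.mem_coe, mem_cylInf] at hx ⊢
  exact hS (inf_le_inf_right w hxy) hx

omit [DecidableLE α] in
/-- The cylinder is `w`-determined. [this work] -/
theorem mem_cylInf_iff_inf_mem {S : Finset α} {w : α} (x : α) : x ∈ cylInf S w ↔ x ⊓ w ∈ cylInf S w := by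
  rw [mem_cylInf, mem_cylInf, inf_assoc, inf_idem]

omit [DecidableEq α] in
/-- The top section `A*` is `w`-determined. [this work] -/
theorem mem_starUp_iff_inf_mem (A : Finset α) (w x : α) : x ∈ starUp A w ↔ x ⊓ w ∈ starUp A w :=
  ⟨fun hx => inf_mem_starUp le_rfl hx, fun hx => isUpperSet_starUp A w (inf_le_left : x ⊓ w ≤ x) hx⟩

/-- **`A* ∩ B* = A ∩ B`** when `A ∩ B` is `w`-determined. [this work] -/
theorem starUp_inter_starUp_of_determined {A B : Finset α} {w : α} (hA : IsUpperSet (A : Set α)) (hB : IsUpperSet (B : Set α))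
    (hK : ∀ x, x ∈ A ∩ B ↔ x ⊓ w ∈ A ∩ B) : starUp A w ∩ starUp B w = A ∩ B := by
  ext x
  rw [Finset.mem_inter, mem_starUp, mem_starUp]
  refine ⟨fun h => ?_, fun hx => ?_⟩
  · obtain ⟨⟨a', ha', hale⟩, ⟨b', hb', hble⟩⟩ := h
    -- `z = a' ⊔ b' ⊔ x ∈ A ∩ B`, hence `z ⊓ w ∈ A ∩ B`, and `z ⊓ w ≤ x`
    have hzA : a' ⊔ b' ⊔ x ∈ A := hA (le_trans le_sup_left le_sup_left : a' ≤ a' ⊔ b' ⊔ x) ha'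
    have hzB : a' ⊔ b' ⊔ x ∈ B := hB (le_trans le_sup_right le_sup_left : b' ≤ a' ⊔ b' ⊔ x) hb'
    have hz : (a' ⊔ b' ⊔ x) ⊓ w ∈ A ∩ B := (hK _).1 (Finset.mem_inter.2 ⟨hzA, hzB⟩)
    have hle : (a' ⊔ b' ⊔ x) ⊓ w ≤ x := by
      rw [inf_sup_right, inf_sup_right]
      exact sup_le (sup_le hale hble) inf_le_left
    have hAB : IsUpperSet (((A ∩ B : Finset α)) : Set α) := by rw [Finset.coe_inter]; exact hA.inter hB
    exact Finset.mem_coe.1 (hAB hle hz)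
  · exact ⟨⟨x, (Finset.mem_inter.1 hx).1, inf_le_left⟩, ⟨x, (Finset.mem_inter.1 hx).2, inf_le_left⟩⟩

/-! ### Step 1: domination by the top sections -/

omit [DistribLattice α] [Fintype α] [DecidableLE α] in
/-- `Σ_{x∈V} μ x · 1_S(x) = m(V ∩ S)`. [folklore] -/
theorem sum_mul_indicator (μ : α → ℝ) (V S : Finset α) :
    ∑ x ∈ V, μ x * (if x ∈ S then (1 : ℝ) else 0) = mass μ (V ∩ S) := by
  simp only [mul_ite, mul_one, mul_zero]
  rw [Finset.sum_ite_mem]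
  rfl

/-- Pointwise domination `μ x · densStar x ≤ μ x · density μ A B x` (`A ⊆ A*`, `B ⊆ B*`, coefficients `Za, Zb ≥ 0`). [this work] -/
theorem mul_densStar_le {μ : α → ℝ} (hμ₀ : 0 ≤ μ) (A B : Finset α) (w x : α) :
    μ x * densStar μ A B w x ≤ μ x * density μ A B x := by
  have hZ := mass_nonneg hμ₀ (univ : Finset α)
  have ha := mass_nonneg hμ₀ A
  have hb := mass_nonneg hμ₀ B
  have hx := hμ₀ x
  have h1 : (if x ∈ B then (1 : ℝ) else 0) ≤ (if x ∈ starUp B w then (1 : ℝ) else 0) := by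
    by_cases hxB : x ∈ B
    · rw [if_pos hxB, if_pos (subset_starUp B w hxB)]
    · rw [if_neg hxB]; split_ifs <;> norm_num
  have h2 : (if x ∈ A then (1 : ℝ) else 0) ≤ (if x ∈ starUp A w then (1 : ℝ) else 0) := by
    by_cases hxA : x ∈ A
    · rw [if_pos hxA, if_pos (subset_starUp A w hxA)]
    · rw [if_neg hxA]; split_ifs <;> norm_num
  have key : μ x * density μ A B x - μ x * densStar μ A B w x =
      μ x * (mass μ univ * mass μ A) * ((if x ∈ starUp B w then (1 : ℝ) else 0) - (if x ∈ B then (1 : ℝ) else 0))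
        + μ x * (mass μ univ * mass μ B) *
          ((if x ∈ starUp A w then (1 : ℝ) else 0) - (if x ∈ A then (1 : ℝ) else 0)) := by
    unfold density densStar; ring
  have t1 : 0 ≤ μ x * (mass μ univ * mass μ A) *
      ((if x ∈ starUp B w then (1 : ℝ) else 0) - (if x ∈ B then (1 : ℝ) else 0)) :=
    mul_nonneg (mul_nonneg hx (mul_nonneg hZ ha)) (sub_nonneg.2 h1)
  have t2 : 0 ≤ μ x * (mass μ univ * mass μ B) *
      ((if x ∈ starUp A w then (1 : ℝ) else 0) - (if x ∈ A then (1 : ℝ) else 0)) :=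
    mul_nonneg (mul_nonneg hx (mul_nonneg hZ hb)) (sub_nonneg.2 h2)
  linarith

/-- **Domination**: `Q(U) = Σ_{x∈U} μ x · densStar x ≤ latticeE3 μ U A B`. [this work] -/
theorem sum_densStar_le_latticeE3 {μ : α → ℝ} (hμ₀ : 0 ≤ μ) (U A B : Finset α) (w : α) :
    ∑ x ∈ U, μ x * densStar μ A B w x ≤ latticeE3 μ U A B := by
  rw [latticeE3_eq_sum_density]
  exact Finset.sum_le_sum fun x _ => mul_densStar_le hμ₀ A B w x

/-! ### Step 2: comparison with the cylinder functional (the tangent corner) -/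

/-- **Comparison**: for every up-set `V`, `latticeE3 μ V A* B* ≤ Q(V)`; the difference is
`(ab − âb̂)m(V) + Z(â − a)m(V ∩ B*) + Z(b̂ − b)m(V ∩ A*) ≥ m(V)(â − a)(b̂ − b) ≥ 0`. [this work] -/
theorem latticeE3_star_le_sum_densStar {μ : α → ℝ} (hμ₀ : 0 ≤ μ) (hμ : ∀ a b, μ a * μ b ≤ μ (a ⊓ b) * μ (a ⊔ b))
    {V A B : Finset α} (hV : IsUpperSet (V : Set α)) (hA : IsUpperSet (A : Set α)) (hB : IsUpperSet (B : Set α))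
    {w : α} (hK : ∀ x, x ∈ A ∩ B ↔ x ⊓ w ∈ A ∩ B) :
    latticeE3 μ V (starUp A w) (starUp B w) ≤ ∑ x ∈ V, μ x * densStar μ A B w x := by
  have hstar := starUp_inter_starUp_of_determined hA hB hK
  rw [latticeE3_eq_sum_density, ← sub_nonneg, ← Finset.sum_sub_distrib]
  have hpt : ∀ x, μ x * densStar μ A B w x - μ x * density μ (starUp A w) (starUp B w) x =
      (mass μ A * mass μ B - mass μ (starUp A w) * mass μ (starUp B w)) * μ x
        + mass μ univ * (mass μ (starUp A w) - mass μ A) * (μ x * (if x ∈ starUp B w then (1 : ℝ) else 0))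
        + mass μ univ * (mass μ (starUp B w) - mass μ B) * (μ x * (if x ∈ starUp A w then (1 : ℝ) else 0)) := by
    intro x
    unfold densStar density
    rw [hstar]
    ring
  rw [Finset.sum_congr rfl (fun x _ => hpt x), Finset.sum_add_distrib, Finset.sum_add_distrib, ← Finset.mul_sum,
    ← Finset.mul_sum, ← Finset.mul_sum, sum_mul_indicator, sum_mul_indicator]
  have hZ := mass_nonneg hμ₀ (univ : Finset α)
  have hmV := mass_nonneg hμ₀ V
  have haa : mass μ A ≤ mass μ (starUp A w) := mass_mono hμ₀ (subset_starUp A w)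
  have hbb : mass μ B ≤ mass μ (starUp B w) := mass_mono hμ₀ (subset_starUp B w)
  have hVA := fkg_upperSet_mass hμ₀ hμ hV (isUpperSet_starUp A w)
  have hVB := fkg_upperSet_mass hμ₀ hμ hV (isUpperSet_starUp B w)
  have hU : ∑ x ∈ V, μ x = mass μ V := rfl
  rw [hU]
  -- `(ab − âb̂)m(V) + (â − a)·Z m(V∩B*) + (b̂ − b)·Z m(V∩A*) ≥ m(V)(â − a)(b̂ − b)`
  have t1 : (mass μ (starUp A w) - mass μ A) * (mass μ V * mass μ (starUp B w)) ≤
      (mass μ (starUp A w) - mass μ A) * (mass μ univ * mass μ (V ∩ starUp B w)) :=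
    mul_le_mul_of_nonneg_left hVB (sub_nonneg.2 haa)
  have t2 : (mass μ (starUp B w) - mass μ B) * (mass μ V * mass μ (starUp A w)) ≤
      (mass μ (starUp B w) - mass μ B) * (mass μ univ * mass μ (V ∩ starUp A w)) :=
    mul_le_mul_of_nonneg_left hVA (sub_nonneg.2 hbb)
  have t3 : 0 ≤ mass μ V * ((mass μ (starUp A w) - mass μ A) * (mass μ (starUp B w) - mass μ B)) :=
    mul_nonneg hmV (mul_nonneg (sub_nonneg.2 haa) (sub_nonneg.2 hbb))
  have key : (mass μ A * mass μ B - mass μ (starUp A w) * mass μ (starUp B w)) * mass μ V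
      + mass μ univ * (mass μ (starUp A w) - mass μ A) * mass μ (V ∩ starUp B w)
      + mass μ univ * (mass μ (starUp B w) - mass μ B) * mass μ (V ∩ starUp A w)
      = ((mass μ (starUp A w) - mass μ A) * (mass μ univ * mass μ (V ∩ starUp B w))
          - (mass μ (starUp A w) - mass μ A) * (mass μ V * mass μ (starUp B w)))
        + ((mass μ (starUp B w) - mass μ B) * (mass μ univ * mass μ (V ∩ starUp A w))
          - (mass μ (starUp B w) - mass μ B) * (mass μ V * mass μ (starUp A w)))
        + mass μ V * ((mass μ (starUp A w) - mass μ A) * (mass μ (starUp B w) - mass μ B)) := by ring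
  rw [key]
  linarith [t1, t2, t3]

/-! ### Step 3: grouping by the fibres of `x ↦ x ⊓ w`; ratio monotonicity -/

/-- `densStar` is `w`-determined (when `A ∩ B` is). [this work] -/
theorem densStar_inf {μ : α → ℝ} {A B : Finset α} {w : α} (hK : ∀ x, x ∈ A ∩ B ↔ x ⊓ w ∈ A ∩ B) (x : α) :
    densStar μ A B w (x ⊓ w) = densStar μ A B w x := by
  have e1 : (if x ⊓ w ∈ A ∩ B then (1 : ℝ) else 0) = (if x ∈ A ∩ B then (1 : ℝ) else 0) := by
    by_cases h : x ∈ A ∩ B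
    · rw [if_pos h, if_pos ((hK x).1 h)]
    · rw [if_neg h, if_neg (fun h' => h ((hK x).2 h'))]
  have e2 : (if x ⊓ w ∈ starUp B w then (1 : ℝ) else 0) = (if x ∈ starUp B w then (1 : ℝ) else 0) := by
    by_cases h : x ∈ starUp B w
    · rw [if_pos h, if_pos ((mem_starUp_iff_inf_mem B w x).1 h)]
    · rw [if_neg h, if_neg (fun h' => h ((mem_starUp_iff_inf_mem B w x).2 h'))]
  have e3 : (if x ⊓ w ∈ starUp A w then (1 : ℝ) else 0) = (if x ∈ starUp A w then (1 : ℝ) else 0) := by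
    by_cases h : x ∈ starUp A w
    · rw [if_pos h, if_pos ((mem_starUp_iff_inf_mem A w x).1 h)]
    · rw [if_neg h, if_neg (fun h' => h ((mem_starUp_iff_inf_mem A w x).2 h'))]
  unfold densStar
  rw [e1, e2, e3]

/-- **Grouping by fibres**: `Q(U) = Σ_z densStar z · m(U ∩ {x ⊓ w = z})`. [this work] -/
theorem sum_densStar_eq_sum_fibre {μ : α → ℝ} {A B : Finset α} {w : α} (hK : ∀ x, x ∈ A ∩ B ↔ x ⊓ w ∈ A ∩ B)
    (U : Finset α) :
    ∑ x ∈ U, μ x * densStar μ A B w x = ∑ z, densStar μ A B w z * mass μ (infFibre U w z) := by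
  rw [← Finset.sum_fiberwise U (fun x => x ⊓ w) (fun x => μ x * densStar μ A B w x)]
  refine Finset.sum_congr rfl fun z _ => ?_
  rw [show mass μ (infFibre U w z) = ∑ x ∈ U.filter (fun x => x ⊓ w = z), μ x from rfl, Finset.mul_sum]
  refine Finset.sum_congr rfl fun x hx => ?_
  have hxz : x ⊓ w = z := (Finset.mem_filter.1 hx).2
  show μ x * densStar μ A B w x = densStar μ A B w z * μ x
  rw [← densStar_inf hK x, hxz, mul_comm]

omit [DecidableLE α] in
/-- `m(U ∩ fibre) ≤ m(fibre)`, both nonnegative. [this work] -/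
theorem mass_infFibre_le {μ : α → ℝ} (hμ₀ : 0 ≤ μ) (U : Finset α) (w z : α) :
    mass μ (infFibre U w z) ≤ mass μ (infFibre univ w z) :=
  mass_mono hμ₀ (Finset.filter_subset_filter _ (Finset.subset_univ U))

omit [DecidableLE α] in
/-- **Ratio monotonicity** (Ahlswede–Daykin): for an up-set `U` and `z ≤ z'`,
`m(U ∩ F_z)·m(F_{z'}) ≤ m(F_z)·m(U ∩ F_{z'})`, `F_z = {x | x ⊓ w = z}` — i.e. `μ(U | x ⊓ w = z)` increases with `z` (Holley).
[this work] -/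
theorem mass_infFibre_ratio_mono {μ : α → ℝ} (hμ₀ : 0 ≤ μ) (hμ : ∀ a b, μ a * μ b ≤ μ (a ⊓ b) * μ (a ⊔ b))
    {U : Finset α} (hU : IsUpperSet (U : Set α)) (w : α) {z z' : α} (hzz' : z ≤ z') :
    mass μ (infFibre U w z) * mass μ (infFibre univ w z') ≤ mass μ (infFibre univ w z) * mass μ (infFibre U w z') := by
  have hif : ∀ (S : Finset α) (y : α), 0 ≤ (if y ∈ S then μ y else 0) := by
    intro S y; split_ifs; exacts [hμ₀ y, le_rfl]
  have hsum : ∀ S : Finset α, ∑ y, (if y ∈ S then μ y else 0) = mass μ S := by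
    intro S; rw [Finset.sum_ite_mem, Finset.univ_inter]; rfl
  have key := four_functions_theorem_univ
    (fun y => if y ∈ infFibre U w z then μ y else 0)
    (fun y => if y ∈ infFibre univ w z' then μ y else 0)
    (fun y => if y ∈ infFibre univ w z then μ y else 0)
    (fun y => if y ∈ infFibre U w z' then μ y else 0)
    (fun y => hif _ y) (fun y => hif _ y) (fun y => hif _ y) (fun y => hif _ y)
    (fun x y => show (if x ∈ infFibre U w z then μ x else 0) * (if y ∈ infFibre univ w z' then μ y else 0) ≤
        (if x ⊓ y ∈ infFibre univ w z then μ (x ⊓ y) else 0) * (if x ⊔ y ∈ infFibre U w z' then μ (x ⊔ y) else 0) from by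
      by_cases hx : x ∈ infFibre U w z
      · by_cases hy : y ∈ infFibre univ w z'
        · obtain ⟨hxU, hxz⟩ := mem_infFibre.1 hx
          obtain ⟨-, hyz⟩ := mem_infFibre.1 hy
          have hinf : x ⊓ y ∈ infFibre univ w z := by
            rw [mem_infFibre]
            refine ⟨Finset.mem_univ _, ?_⟩
            rw [inf_inf_distrib_right, hxz, hyz, inf_eq_left.2 hzz']
          have hsup : x ⊔ y ∈ infFibre U w z' := by
            rw [mem_infFibre]
            refine ⟨hU (le_sup_left : x ≤ x ⊔ y) hxU, ?_⟩
            rw [inf_sup_right, hxz, hyz, sup_eq_right.2 hzz']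
          rw [if_pos hx, if_pos hy, if_pos hinf, if_pos hsup]
          exact hμ x y
        · rw [if_neg hy, mul_zero]
          exact mul_nonneg (hif _ _) (hif _ _)
      · rw [if_neg hx, zero_mul]
        exact mul_nonneg (hif _ _) (hif _ _))
  simp only [hsum] at key
  exact key

end Summit.CriticalPhenomena.PercolationContinuityZ3.Theorems.SahiE3DeterminedMeetFKG
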